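import Summits.PneNP.PneNP.Theorems.ExpanderLinearGeneratorsResKParams
import HarnessLib

/-!
# The `Res(k)` rung for expanding linear systems, XI: assembly

Support file for `stmt-PneNP-11443` (`LinearGeneratorDepthFregeHard`, Krajíček's Problem 19.4.5 in
universal-expander form). THE `Res(k)` RUNG OF THE LADDER, FOR ALL COLUMN WEIGHTS
(`resK_lowerBound_expander`): for `1 ≤ k`, `8k ≤ 3ℓ`, `0 < δ` and `δ (k² + k + 2) < 2` there are
`ε > 0` and `N` such that for every `n ≥ N`, every system `E` of linear equations over `𝔽₂` in `n`
unknowns whose row supports form an `(n^{1-δ}, 3ℓ/4)`-boundary expander, and every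
`R(k)`-refutation `π` of its XOR-CNF `sumEncoding 1 E`, the number of lines of `π` is at least
`2^{n^ε}`. No sparsity and no bound on the column weight is assumed — the heavy case (a variable
in three or more equations, the open core of the crux) is included; for `k = 1` this is the
resolution-size rung (`δ < 1/2`).

Proof (files I–X): hit `π` with the expansion-preserving random restriction `ρ(u, y)` (file VII).
By the switching lemma (file IX) and the abort bound (file VI), if `|π| < 2^{n^ε}` some good
sample point leaves EVERY line of `π` with a strong decision tree of height `H = hgt M k T`,
`3H < c r / 8` (file X); but then (file IV) the restricted XOR-CNF has a resolution refutation of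
width `3H`, contradicting the relative width bound for the `(r/2, c/2)`-expander of non-closure
rows (files I, V).

[Alekhnovich 2011, Thm. 1.2 / §4 (Res(k) lower bounds for random 3-XOR via expansion-preserving
restrictions); Segerlind–Buss–Impagliazzo 2004, Thm. 3.x, Thm. 5.1; Ben-Sasson–Wigderson 2001,
Thm. 6.5; Krajíček 2019, §13.4 and Problem 19.4.5]
-/

namespace Summit.PneNP.PneNP.Theorems.ResKRestriction

open Finset Filter Literature.Computability.Complexity Literature.Computability.MetaComplexity

variable {m n : ℕ}

/-! ### A good sample point where every line has a shallow strong tree -/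

/-- **The union bound.** If the non-good `u` are at most half of all `u`, and
`|π| · 2^{-T} < 1/2`, then some good sample point gives every line of `π` (all `k`-DNFs on
variables `< V`) a strong decision tree of height `hgt M k T` under `rho`.
[Segerlind–Buss–Impagliazzo 2004, §3 (union bound over the lines); Alekhnovich 2011, §4] [folklore] -/
theorem exists_good_point {E : Fin m → LinEqMod 2 n} {r c : ℝ} {V M : ℕ}
    (hexp : IsBoundaryExpander (rowVars E) r c) (hc : 0 < c) (hnV : n ≤ V) (hM : 1 ≤ M)
    {k : ℕ} (hkc : 2 * (k : ℝ) ≤ c) (π : List (ResKLine ℕ)) (hπk : ∀ L ∈ π, IsKDNF k L.dnf)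
    (hπV : ∀ L ∈ π, ∀ t ∈ L.dnf, ∀ l ∈ t, l.1 < V) (T : ℕ)
    (hS : (π.length : ℝ) * ((2 : ℝ) ^ T)⁻¹ < 1 / 2)
    (hab : ((((Finset.univ : Finset (Fin V → Fin M)).filter
      fun u => ¬ Good (n := n) r c V M u).card : ℝ)) ≤ (M : ℝ) ^ V / 2) :
    ∃ (u : Fin V → Fin M) (y : Fin V → Bool), Good (n := n) r c V M u ∧
      ∀ L ∈ π, Ev L.dnf (rho E r c V M u y) (hgt M k T) := by
  classical
  set BadU : Finset ((Fin V → Fin M) × (Fin V → Bool)) :=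
    Finset.univ.filter fun p => ¬ Good (n := n) r c V M p.1 with hBadU
  set BadL : Finset ((Fin V → Fin M) × (Fin V → Bool)) :=
    π.toFinset.biUnion fun L => badSet (n := n) E r c V M L.dnf (hgt M k T) with hBadL
  -- cardinalities
  have hU : (BadU.card : ℝ) ≤ (M : ℝ) ^ V / 2 * (2 : ℝ) ^ V := by
    have heq : BadU = ((Finset.univ : Finset (Fin V → Fin M)).filter
        fun u => ¬ Good (n := n) r c V M u) ×ˢ (Finset.univ : Finset (Fin V → Bool)) := by
      ext p; simp [hBadU]
    rw [heq, Finset.card_product, Finset.card_univ, Fintype.card_fun, Fintype.card_bool,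
      Fintype.card_fin]
    push_cast
    exact mul_le_mul_of_nonneg_right hab (by positivity)
  have hL : (BadL.card : ℝ) < (M : ℝ) ^ V * (2 : ℝ) ^ V / 2 := by
    calc (BadL.card : ℝ) ≤ ∑ L ∈ π.toFinset, ((badSet (n := n) E r c V M L.dnf (hgt M k T)).card : ℝ) := by
          rw [hBadL]; exact_mod_cast Finset.card_biUnion_le
      _ ≤ ∑ L ∈ π.toFinset, (M : ℝ) ^ V * (2 : ℝ) ^ V * ((2 : ℝ) ^ T)⁻¹ :=
          Finset.sum_le_sum fun L hL => card_badSet_le hexp hc hnV hM hkc k le_rfl T L.dnf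
            (hπk L (List.mem_toFinset.1 hL)) (hπV L (List.mem_toFinset.1 hL))
      _ = π.toFinset.card * ((M : ℝ) ^ V * (2 : ℝ) ^ V * ((2 : ℝ) ^ T)⁻¹) := by
          rw [Finset.sum_const, nsmul_eq_mul]
      _ ≤ π.length * ((M : ℝ) ^ V * (2 : ℝ) ^ V * ((2 : ℝ) ^ T)⁻¹) := by
          gcongr; exact_mod_cast List.toFinset_card_le π
      _ = ((π.length : ℝ) * ((2 : ℝ) ^ T)⁻¹) * ((M : ℝ) ^ V * (2 : ℝ) ^ V) := by ring
      _ < 1 / 2 * ((M : ℝ) ^ V * (2 : ℝ) ^ V) := mul_lt_mul_of_pos_right hS (by positivity)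
      _ = (M : ℝ) ^ V * (2 : ℝ) ^ V / 2 := by ring
  have hlt : ((BadU ∪ BadL).card : ℝ) < (Finset.univ : Finset ((Fin V → Fin M) × (Fin V → Bool))).card := by
    rw [Finset.card_univ, Fintype.card_prod, Fintype.card_fun, Fintype.card_fun, Fintype.card_bool,
      Fintype.card_fin, Fintype.card_fin]
    push_cast
    have := Finset.card_union_le BadU BadL
    have : ((BadU ∪ BadL).card : ℝ) ≤ BadU.card + BadL.card := by exact_mod_cast this
    linarith
  have hne : BadU ∪ BadL ≠ Finset.univ := by
    intro h; rw [h] at hlt; exact lt_irrefl _ hlt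
  obtain ⟨p, -, hp⟩ : ∃ p ∈ (Finset.univ : Finset ((Fin V → Fin M) × (Fin V → Bool))), p ∉ BadU ∪ BadL := by
    by_contra hall
    push Not at hall
    exact hne (Finset.eq_univ_iff_forall.2 fun p => hall p (Finset.mem_univ p))
  rw [Finset.mem_union, not_or] at hp
  have hgood : Good (n := n) r c V M p.1 := by
    by_contra hng
    exact hp.1 (by rw [hBadU]; simp [hng])
  refine ⟨p.1, p.2, hgood, fun L hLπ => ?_⟩
  by_contra hev
  refine hp.2 ?_
  rw [hBadL, Finset.mem_biUnion]
  exact ⟨L, List.mem_toFinset.2 hLπ, mem_badSet.2 ⟨hgood, hev⟩⟩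

/-- **The abort bound**: the non-good `u` are few:
`#{u : ¬ good} ≤ M^V · exp(n/M) / 2^{⌊c r/4⌋ + 1}` (`n ≤ V`, `M ≥ 1`, `c r ≥ 0`).
[Alekhnovich 2011, §3 (the restriction aborts with small probability)] [folklore] -/
theorem card_not_good_le {r c : ℝ} {V M : ℕ} (hnV : n ≤ V) (hM : 1 ≤ M) (hcr : 0 ≤ c * r) :
    ((((Finset.univ : Finset (Fin V → Fin M)).filter fun u => ¬ Good (n := n) r c V M u).card : ℝ)) ≤
      (M : ℝ) ^ V * Real.exp ((n : ℝ) / M) * ((2 : ℝ) ^ (⌊c * r / 4⌋₊ + 1))⁻¹ := by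
  refine le_trans ?_ (card_zeros_ge_le hM hnV (⌊c * r / 4⌋₊ + 1))
  exact_mod_cast Finset.card_le_card fun u hu => by
    simp only [Finset.mem_filter, Finset.mem_univ, true_and, Good, not_le] at hu ⊢
    rw [card_sysPart_Jset] at hu
    exact Nat.floor_lt (by positivity) |>.2 hu

/-! ### The variables of a refutation -/

/-- A bound on all variables occurring in the lines of `π`. [folklore] -/
def varBound (π : List (ResKLine ℕ)) : ℕ :=
  ((π.map fun L => L.dnf.biUnion tvars).toFinset.biUnion id).sup id + 1

/-- Every variable of every term of every line of `π` is `< varBound π`. [folklore] -/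
theorem lt_varBound {π : List (ResKLine ℕ)} {L : ResKLine ℕ} (hL : L ∈ π)
    {t : Finset (Literal ℕ)} (ht : t ∈ L.dnf) {l : Literal ℕ} (hl : l ∈ t) : l.1 < varBound π := by
  unfold varBound
  have hmem : l.1 ∈ (π.map fun L => L.dnf.biUnion tvars).toFinset.biUnion id := by
    rw [Finset.mem_biUnion]
    refine ⟨L.dnf.biUnion tvars, List.mem_toFinset.2 (List.mem_map.2 ⟨L, hL, rfl⟩), ?_⟩
    rw [id, Finset.mem_biUnion]
    exact ⟨t, ht, mem_tvars.2 ⟨l.2, by simp [hl]⟩⟩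
  have := Finset.le_sup (f := id) hmem
  simp only [id] at this
  omega

/-! ### The theorem -/

/-- **The `Res(k)` rung for expanding linear systems, all column weights.** For `1 ≤ k`,
`8k ≤ 3ℓ`, `0 < δ` and `δ (k² + k + 2) < 2` there are `ε > 0` and `N` such that for all `n ≥ N`,
every `E : Fin m → LinEqMod 2 n` whose row supports form an `(n^{1-δ}, 3ℓ/4)`-boundary expander,
and every `R(k)`-refutation `π` of `sumEncoding 1 E`: `2^{n^ε} ≤ resKSize π`. This is the
`Res(k)` analogue of the crux `LinearGeneratorDepthFregeHard` (depth-`d` Frege replaced by `k`-DNF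
resolution), proved for the HEAVY case as well; `k = 1` is the resolution-size rung (`δ < 1/2`).
[Alekhnovich 2011, Thm. 1.2, §3–4; Segerlind–Buss–Impagliazzo 2004, §3, §5;
Krajíček 2019, Problem 19.4.5] [cite: KrajicekProofComplexity2019, Problem 19.4.5] -/
theorem resK_lowerBound_expander (ℓ k : ℕ) (δ : ℝ) (hk : 1 ≤ k) (hkl : 8 * k ≤ 3 * ℓ) (hδ : 0 < δ)
    (hδk : δ * ((k : ℝ) ^ 2 + k + 2) < 2) :
    ∃ ε : ℝ, 0 < ε ∧ ∃ N : ℕ, ∀ n : ℕ, N ≤ n → ∀ (m : ℕ) (E : Fin m → LinEqMod 2 n),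
      IsBoundaryExpander (fun i => (E i).supp.map Fin.valEmbedding) ((n : ℝ) ^ (1 - δ)) (3 / 4 * ℓ) →
      ∀ π : List (ResKLine ℕ), IsResKRefutation k (sumEncoding 1 E) π →
        (2 : ℝ) ^ ((n : ℝ) ^ ε) ≤ (resKSize π : ℝ) := by
  -- constants
  set c : ℝ := 3 / 4 * ℓ with hcdef
  have hℓ : (3 : ℝ) ≤ ℓ := by
    have : 3 ≤ ℓ := by omega
    exact_mod_cast this
  have hc : 0 < c := by rw [hcdef]; linarith
  have hkc : 2 * (k : ℝ) ≤ c := by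
    have : ((8 * k : ℕ) : ℝ) ≤ ((3 * ℓ : ℕ) : ℝ) := by exact_mod_cast hkl
    push_cast at this; rw [hcdef]; linarith
  have htri : ((tri k : ℕ) : ℝ) = ((k : ℝ) ^ 2 + k) / 2 := cast_tri k
  have hγ : 0 < 1 - δ * (1 + tri k) := by rw [htri]; nlinarith
  have hδ1 : δ < 1 := by
    have : (0 : ℝ) ≤ tri k := Nat.cast_nonneg _
    nlinarith
  set γ := 1 - δ * (1 + tri k) with hγdef
  refine ⟨γ / 2, by positivity, ?_⟩
  obtain ⟨N, hN⟩ := Filter.eventually_atTop.1 (eventually_params hc hδ k hγ)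
  refine ⟨N, fun n hn m E hexp π hπ => ?_⟩
  obtain ⟨hr4, hr6, hc32, hε2, hmain⟩ := hN n hn
  set r : ℝ := (n : ℝ) ^ (1 - δ) with hrdef
  have hexp' : IsBoundaryExpander (rowVars E) r c := hexp
  have hr0 : 0 < r := by linarith
  have hn0 : (0 : ℝ) ≤ n := Nat.cast_nonneg n
  have hnpos : 0 < n := by
    rcases Nat.eq_zero_or_pos n with h | h
    · exfalso; subst h
      have h1 : (1 : ℝ) - δ ≠ 0 := by linarith
      have : r = 0 := by rw [hrdef, Nat.cast_zero, Real.zero_rpow h1]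
      linarith
    · exact h
  have hnreal : (n : ℝ) = (n : ℝ) ^ δ * r := by
    have h1 : (0 : ℝ) ≤ 1 - δ := by linarith
    rw [hrdef, ← Real.rpow_add_of_nonneg hn0 hδ.le h1]
    norm_num
  have hnδ : 0 < (n : ℝ) ^ δ := Real.rpow_pos_of_pos (by exact_mod_cast hnpos) _
  have hcr32 : c * r ≤ 32 * n := by
    rw [hnreal]; nlinarith
  -- suppose the refutation is short
  by_contra hlt
  push Not at hlt
  rw [resKSize_eq_length] at hlt
  -- the parameters `M`, `T`, `V`, `H`
  obtain ⟨hM1, hnM, hM64⟩ := ceil_params hc hr0 hnpos hcr32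
  set M := ⌈32 * (n : ℝ) / (c * r)⌉₊ with hMdef
  set T := ⌊(n : ℝ) ^ (γ / 2)⌋₊ + 2 with hTdef
  have hT1 : 1 ≤ T := by omega
  set V := max n (varBound π) with hVdef
  have hnV : n ≤ V := le_max_left _ _
  have hπV : ∀ L ∈ π, ∀ t ∈ L.dnf, ∀ l ∈ t, l.1 < V := fun L hL t ht l hl =>
    lt_of_lt_of_le (lt_varBound hL ht hl) (le_max_right _ _)
  have hπk : ∀ L ∈ π, IsKDNF k L.dnf := by
    intro L hL
    obtain ⟨i, hi, rfl⟩ := List.getElem_of_mem hL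
    exact (hπ.1 i hi).1
  -- the height is small: `3 H < c r / 8`
  have hM64' : (M : ℝ) ≤ 64 / c * (n : ℝ) ^ δ := by
    calc (M : ℝ) ≤ 64 * n / (c * r) := hM64
      _ = 64 * ((n : ℝ) ^ δ * r) / (c * r) := by rw [← hnreal]
      _ = 64 / c * (n : ℝ) ^ δ := by field_simp
  have hTle : (T : ℝ) ≤ (n : ℝ) ^ (γ / 2) + 2 := by
    rw [hTdef]; push_cast
    linarith [Nat.floor_le (Real.rpow_nonneg hn0 (γ / 2))]
  have hH : (3 * (hgt M k T) : ℝ) < c * r / 8 := by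
    have h1 := hgt_le hM1 k T hT1
    have h2 : (M : ℝ) ^ tri k ≤ (64 / c * (n : ℝ) ^ δ) ^ tri k :=
      pow_le_pow_left₀ (by positivity) hM64' _
    have hB : (0 : ℝ) ≤ Bconst k := Nat.cast_nonneg _
    calc (3 * (hgt M k T) : ℝ) ≤ 3 * ((Bconst k : ℝ) * (M : ℝ) ^ tri k * T) := by linarith
      _ ≤ 3 * ((Bconst k : ℝ) * (64 / c * (n : ℝ) ^ δ) ^ tri k * ((n : ℝ) ^ (γ / 2) + 2)) := by
          gcongr
      _ = 3 * (Bconst k : ℝ) * (64 / c * (n : ℝ) ^ δ) ^ tri k * ((n : ℝ) ^ (γ / 2) + 2) := by ring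
      _ < c * r / 8 := hmain
  -- the two halves of the union bound
  have hS : (π.length : ℝ) * ((2 : ℝ) ^ T)⁻¹ < 1 / 2 := size_mul_inv_two_pow_lt_half hlt
  have hab : ((((Finset.univ : Finset (Fin V → Fin M)).filter
      fun u => ¬ Good (n := n) r c V M u).card : ℝ)) ≤ (M : ℝ) ^ V / 2 := by
    refine (card_not_good_le hnV hM1 (by positivity)).trans ?_
    have h1 : Real.exp ((n : ℝ) / M) ≤ Real.exp (c * r / 32) := Real.exp_le_exp.2 hnM
    have h2 := exp_mul_inv_two_pow_le_half hr6
    have h3 : (0 : ℝ) ≤ ((2 : ℝ) ^ (⌊c * r / 4⌋₊ + 1))⁻¹ := by positivity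
    calc (M : ℝ) ^ V * Real.exp ((n : ℝ) / M) * ((2 : ℝ) ^ (⌊c * r / 4⌋₊ + 1))⁻¹
        ≤ (M : ℝ) ^ V * (Real.exp (c * r / 32) * ((2 : ℝ) ^ (⌊c * r / 4⌋₊ + 1))⁻¹) := by
          rw [mul_assoc]; gcongr
      _ ≤ (M : ℝ) ^ V * (1 / 2) := by gcongr
      _ = (M : ℝ) ^ V / 2 := by ring
  -- a good sample point with shallow trees everywhere — impossible
  obtain ⟨u, y, hu, hall⟩ := exists_good_point hexp' hc hnV hM1 hkc π hπk hπV T hS hab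
  obtain ⟨L, hL, hnot⟩ := exists_line_not_ev hexp' hc hu hr4 hH hπ y
  exact hnot (hall L hL)

end Summit.PneNP.PneNP.Theorems.ResKRestriction
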